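import Summits.BirchSwinnertonDyer.BirchSwinnertonDyer.Theorems.ResidualThetaTransportAtTwoSignedMuVanishingAtTwoPlusMultOneOldFamilyGeneric
import Summits.BirchSwinnertonDyer.BirchSwinnertonDyer.Theorems.ResidualThetaTransportAtTwoSignedMuVanishingAtTwoPlusMultOneTurnkey
import Summits.BirchSwinnertonDyer.BirchSwinnertonDyer.Theorems.ResidualThetaTransportAtTwoCuspSpanDefs
import HarnessLib

/-!
# Route `ResidualThetaTransportAtTwo`, crux Kμ⁺ `SignedMuVanishingAtTwoPlus` (stmt-BirchSwinnertonDyer-20689), line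
# `birth`, stub `stub_flatMuZeroAtTwo`: the spanning statement (G′)_{N₀} AT THE ANCHOR LEVEL discharges the per-class
# `L`-value residue of the old-class turnkeys — FLAT propagates from `CuspSpanEvenAtTwo N₀` to the old families above `N₀`

Cell `bsd-wall`, width seat `bsd-wall-rtt-p4-w2` (g5). THEOREMS ONLY (no `def`, no named fact, no `sorry`); helper `--supports`
the crux; closes nothing. BSD is not proved by this; the four print facts of the (MO⁺) dictionary stay hypotheses, and
`CuspSpanEvenAtTwo N₀` (`…CuspSpanDefs`, `@[conjecture] def`, nothing asserted) is a hypothesis wherever it appears.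

The two analytic lanes of this crux meet here. (1) The old-class descent of width seat w2 (g3/g4; `…MultOneOldFamilyGeneric`
p622378, `…MultOneTurnkey`): FLAT at a habitat⁺ class `W` (conductor `N_W = N₀·t`) follows from four named print facts, kernel
certificates, parities, and ONE numerical input about the ANCHOR newform `g` of level `N₀` —
`hres : ∃ k ≥ 1, ∃ b odd, ∃ m odd, [b/4^k]⁺_g = [0]⁺_g + m/2` (an odd doubled plus symbol of `g` on a `4^k`-class). (2) The
curve-free spanning statement (G′)_N = `CuspSpanEvenAtTwo N` of leads g4/g5, PROVED by lead g6 for every prime `N = p` with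
`⟨−1, 4⟩ = (ℤ/p)ˣ` (`…CuspSpanFourPowWords/Generate`, p621677 …). THIS FILE: `hres` IS A CONSEQUENCE OF `CuspSpanEvenAtTwo N₀` for
every normalised newform `g` of odd level `N₀` with rational coefficients and EVEN `a₂(g)` (`exists_odd_ratPlusSymbol_of_cuspSpanEvenAtTwo`:
lead g5's `exists_odd_re_cuspSymbol_of_cuspSpan` — the mod-2 plus character of `g` is `T₂`-killed, non-zero, and through the period
homology, so under (G′)_{N₀} it cannot kill every `4^k`-class — read in `ℚ` by `ratPlusSymbol_apply_div_eq_add_half`). Hence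
(`flatAtTwo_of_namedFacts_of_oldSum_of_cuspSpanEvenAtTwo`, `flatAtTwo_turnkey_oldSum_of_cuspSpanEvenAtTwo`,
`flatAtTwo_turnkey_prime_level_of_cuspSpanEvenAtTwo`): in every old-class turnkey the `L`-value / modular-symbol input is replaced by
(G′) AT THE ANCHOR LEVEL `N₀` — NOT at `N_W`. Consequence (numbers, not adjectives): lead g6's prime-level theorem, which by itself
reaches only PRIME conductors (none of the 147 habitat⁺ conductors), now reaches every class whose anchor newform has such a prime
level `p` (e.g. `19a1`, `p = 19`: the theta-habitat class `282093g1 = 19·3·7²·101` of `…MultOneClass282093g`) with NO `L`-value input,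
and for each such `p` the INFINITE family of composite conductors `p·q` of `flatAtTwo_turnkey_prime_level_of_cuspSpanEvenAtTwo`
(still modulo the four named facts and the per-class kernel certificate `W[2] ≃ A'[2]`).

References: R. Pollack, Duke Math. J. 118 (2003) Conj. 6.3, Prop. 6.18 [Pollack2003]; B. Mazur, J. Tate, J. Teitelbaum, Invent.
Math. 84 (1986) §I.8 [MazurTateTeitelbaum1986Invent]; J. E. Cremona, *Algorithms for modular elliptic curves* (1997) §2.8
[CremonaAlgorithms1997]; K. Buzzard, *On level-lowering for mod 2 representations*, Math. Res. Lett. 7 (2000) Prop. 2.4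
[Buzzard2000LevelLoweringModTwo]; H. Darmon, F. Diamond, R. Taylor, *Fermat's Last Theorem* (1995) Lemma 1.38
[DarmonDiamondTaylor1995]; J.-P. Serre, Invent. Math. 15 (1972) Prop. 12 [SerreInventiones1972]; B. Mazur, Invent. Math. 44 (1978)
[Mazur1978].
-/

set_option autoImplicit false
set_option linter.dupNamespace false

noncomputable section

open scoped Classical MatrixGroups ModularForm

open CongruenceSubgroup Field WeierstrassCurve Literature.NumberTheory.EllipticCurves
  Literature.NumberTheory.EllipticCurves.ModularForms Literature.NumberTheory.EllipticCurves.Rank1Residual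
  Literature.NumberTheory.IwasawaTheory Summit.BirchSwinnertonDyer.Rank1Residual.Supersingular
  Summit.BirchSwinnertonDyer.BirchSwinnertonDyer.Theses.ResidualThetaTransportAtTwo

namespace Summit.BirchSwinnertonDyer.BirchSwinnertonDyer.Theorems.SignedMuAtTwo

/-! ## §1. (G′)_{N₀} ⟹ an odd doubled plus symbol of every rational newform of level `N₀` with even `a₂` -/

section Anchor

variable {N₀ : ℕ} [NeZero N₀] (g : CuspForm (Gamma0 N₀) 2)

/-- **(G′) at the anchor level discharges the residue.** For a normalised newform `g ∈ S₂(Γ₀(N₀))` with rational coefficients,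
ODD level `N₀` and EVEN `a₂(g) = a`: if `CuspSpanEvenAtTwo N₀` holds (every additive `ZMod 2`-character of `Γ₀(N₀)` through the
period homology killing the `4^k`-classes is `ψ ∘ d`), then some plus symbol on a `4^k`-cusp is half-odd:
`[b/4^k]⁺_g = [0]⁺_g + m/2` with `k ≥ 1`, `b` odd, `m` odd — verbatim the input `hres` of `flatAtTwo_turnkey_oldSum` /
`flatAtTwo_turnkey_prime_level`. Proof: `exists_odd_re_cuspSymbol_of_cuspSpan` (the mod-2 plus character `χ_g` is additive,
through the period homology, `T₂`-killed since `a + 2 + 1` is odd, and non-zero; under (G′)_{N₀} a `T₂`-killed `ψ∘d` vanishes by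
Hecke–Shimura at `2`, so `χ_g` is odd on some `γ` with `|d(γ)| = 4^k`), then `[b/d]⁺_g = [0]⁺_g + m_γ/2`
(`ratPlusSymbol_apply_div_eq_add_half`) with `b = γ₀₁` odd (`ad − bc = 1`, `d` even) and `[b/(−4^k)]⁺ = [(−b)/4^k]⁺`.
[cite: Pollack2003, Conj. 6.3 and Prop. 6.18] [cite: MazurTateTeitelbaum1986Invent, §I.8] [cite: CremonaAlgorithms1997, §2.8] -/
theorem exists_odd_ratPlusSymbol_of_cuspSpanEvenAtTwo (hg : IsNewform0 g) (hQg : coeffField g = ⊥) (h2N₀ : ¬ 2 ∣ N₀)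
    {a : ℤ} (ha : cuspCoeff g 2 = (a : ℂ)) (haev : Even a) (hG : CuspSpanEvenAtTwo N₀) :
    ∃ k : ℕ, 1 ≤ k ∧ ∃ b : ℤ, Odd b ∧ ∃ m : ℤ, Odd m ∧
      ratPlusSymbol g ((b : ℚ) / 4 ^ k) = ratPlusSymbol g 0 + (m : ℚ) / 2 := by
  have hΩ : plusPeriod g ≠ 0 := (IsNewform0.plusPeriod_pos_holds hg hQg).ne'
  have hT : heckeT (Gamma0 N₀) 2 2 g = ((a : ℤ) : ℂ) • g := by
    rw [IsNewform0.heckeT_eq_coeff_smul hg Nat.prime_two]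
    change cuspCoeff g 2 • g = _
    rw [ha]
  have hpar : Odd (a + 2 + 1) := by
    obtain ⟨r, hr⟩ := haev
    exact ⟨r + 1, by omega⟩
  obtain ⟨γ, ⟨k, hk1, hk⟩, m, hmo, hm⟩ :=
    exists_odd_re_cuspSymbol_of_cuspSpan g hΩ Nat.prime_two h2N₀ hT hpar hG
  have hd0 : (γ : SL(2, ℤ)) 1 1 ≠ 0 := by
    intro h0
    rw [h0, Int.natAbs_zero] at hk
    exact absurd hk.symm (pow_ne_zero k (by norm_num))
  have heven : Even ((γ : SL(2, ℤ)) 1 1) := by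
    have h2 : (2 : ℤ) ∣ (γ : SL(2, ℤ)) 1 1 := by
      rw [← Int.natAbs_dvd_natAbs, hk]
      change 2 ∣ 4 ^ k
      exact dvd_pow (by norm_num) (by omega)
    exact even_iff_two_dvd.mpr h2
  have hb : Odd ((γ : SL(2, ℤ)) 0 1) := odd_apply_zero_one_of_even _ heven
  have hsym := ratPlusSymbol_apply_div_eq_add_half g hg hQg γ hd0 hm
  have h4 : (((4 : ℕ) ^ k : ℕ) : ℤ) = (4 : ℤ) ^ k := by push_cast; ring
  rcases Int.natAbs_eq ((γ : SL(2, ℤ)) 1 1) with h | h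
  · -- `d = 4^k`
    refine ⟨k, hk1, (γ : SL(2, ℤ)) 0 1, hb, m, hmo, ?_⟩
    rw [← hsym, h, hk]
    push_cast
    ring_nf
  · -- `d = −4^k`: `[b/(−4^k)]⁺ = [(−b)/4^k]⁺`
    refine ⟨k, hk1, -(γ : SL(2, ℤ)) 0 1, hb.neg, m, hmo, ?_⟩
    rw [← hsym, h, hk]
    push_cast
    ring_nf

end Anchor

/-! ## §2. The old-class turnkeys with (G′)_{N₀} in place of the `L`-value residue -/

namespace MultOneDictionary

variable {W : WeierstrassCurve ℚ} [W.IsElliptic] [W.IsGloballyMinimal]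

/-- **FLAT at `(W, f)` from a GENERIC old sum, the residue discharged by (G′) at the anchor level.** As
`flatAtTwo_of_namedFacts_of_oldSum` (four named facts; `W` good supersingular at `2`, `a₂(W) = 0`, `Δ_W < 0`; a rational
newform `g` of level `N₀`, `B 2` even, `A p ≡ B p` off `N_W`; an odd index set `S ∋ 1` with `N₀ t ∣ N_W`; the bad-prime identities
`T_p H_S = A_p • H_S + 2 • K_p`), with the LAST input `hres` (one odd doubled plus symbol of `g`) REPLACED by `CuspSpanEvenAtTwo N₀`.
[cite: Pollack2003, Conj. 6.3] [cite: Buzzard2000LevelLoweringModTwo, Prop. 2.4] [cite: DarmonDiamondTaylor1995, §1.6 Lemma 1.38]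
[cite: SerreInventiones1972, §1.11 Prop. 12] [cite: Mazur1978, Thm. 1] -/
theorem flatAtTwo_of_namedFacts_of_oldSum_of_cuspSpanEvenAtTwo (hBuz : buzzard2000_multiplicityOne_gamma0)
    (hSe : serre1972_supersingular_decompositionSubgroup_image) (hSD : heckeSelfDual_torsionBy_J0)
    (hMK : mazurKenku_exists_cyclic_isogeny)
    (hss : GoodSS W 2) (ha : W.frobeniusTrace 2 = 0) (hΔ : W.Δ < 0) [NeZero (W.conductorNorm ℤ)]
    {f : CuspForm (Gamma0 (W.conductorNorm ℤ)) 2} (hf : IsNewformOf W f)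
    (A : ℕ → ℤ) (hA : ∀ p : ℕ, p.Prime → cuspCoeff f p = (A p : ℂ))
    {N₀ : ℕ} [NeZero N₀] (g : CuspForm (Gamma0 N₀) 2) (hg : IsNewform0 g) (hQg : coeffField g = ⊥)
    (B : ℕ → ℤ) (hB : ∀ p : ℕ, p.Prime → cuspCoeff g p = (B p : ℂ)) (haev : Even (B 2))
    (hcongr : ∀ p : ℕ, p.Prime → ¬ p ∣ W.conductorNorm ℤ → ((A p : ℤ) : ZMod 2) = ((B p : ℤ) : ZMod 2))
    (S : Finset ℕ+) (h1S : (1 : ℕ+) ∈ S) (hodd : ∀ t ∈ S, Odd (t : ℕ))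
    (hSN : ∀ t ∈ S, N₀ * (t : ℕ) ∣ W.conductorNorm ℤ)
    (hbad : ∀ (p : ℕ) (hp : p.Prime), p ∣ W.conductorNorm ℤ → ∃ K : CuspForm (Gamma0 (W.conductorNorm ℤ)) 2,
      (∀ γ : Gamma0 (W.conductorNorm ℤ), ∃ m : ℤ, (cuspSymbol K γ).re = m * (plusPeriod g / 2)) ∧
      (haveI : NeZero p := ⟨hp.ne_zero⟩; heckeT (Gamma0 (W.conductorNorm ℤ)) 2 p
        (∑ t ∈ S, degeneracyMap0 N₀ (W.conductorNorm ℤ) (t : ℕ) 2 g)) =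
        ((A p : ℤ) : ℂ) • (∑ t ∈ S, degeneracyMap0 N₀ (W.conductorNorm ℤ) (t : ℕ) 2 g) + (2 : ℂ) • K)
    (hG : CuspSpanEvenAtTwo N₀) :
    ∀ Lplus Lminus : IwasawaAlgebra 2, IsPollackPair f 2 Lplus Lminus → ¬ PowerSeries.C (2 : ℤ_[2]) ∣ Lminus := by
  have h1 : N₀ * 1 ∣ W.conductorNorm ℤ := by simpa using hSN 1 h1S
  have h2N : ¬ 2 ∣ W.conductorNorm ℤ := by
    rw [W.dvd_conductorNorm_iff_not_hasGoodReductionAtPrime 2, not_not]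
    exact hss.1
  have h2N₀ : ¬ 2 ∣ N₀ := fun h ↦ h2N (h.trans ((dvd_mul_right N₀ 1).trans h1))
  exact flatAtTwo_of_namedFacts_of_oldSum hBuz hSe hSD hMK hss ha hΔ hf A hA g hg hQg B hB haev hcongr S h1S hodd hSN hbad
    (exists_odd_ratPlusSymbol_of_cuspSpanEvenAtTwo g hg hQg h2N₀ (hB 2 Nat.prime_two) haev hG)

/-- **Generic per-class turnkey, the residue discharged by (G′) at the anchor level.** As `flatAtTwo_turnkey_oldSum` (the
congruence off `N_W` from an equivariant `W[2] ≃+ A'[2]`), with `hres` REPLACED by `CuspSpanEvenAtTwo N₀` (`N₀` = the level of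
the anchor's newform `g`): inputs = four named facts + kernel certificates + parities + the bad-prime identities + (G′)_{N₀}; NO
`L`-value / modular-symbol input. [cite: Pollack2003, Conj. 6.3] [cite: Buzzard2000LevelLoweringModTwo, Prop. 2.4]
[cite: DarmonDiamondTaylor1995, §1.6 Lemma 1.38] [cite: SerreInventiones1972, §1.11 Prop. 12] [cite: Mazur1978, Thm. 1] -/
theorem flatAtTwo_turnkey_oldSum_of_cuspSpanEvenAtTwo (hBuz : buzzard2000_multiplicityOne_gamma0)
    (hSe : serre1972_supersingular_decompositionSubgroup_image) (hSD : heckeSelfDual_torsionBy_J0)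
    (hMK : mazurKenku_exists_cyclic_isogeny)
    (hss : GoodSS W 2) (ha : W.frobeniusTrace 2 = 0) (hΔ : W.Δ < 0) [NeZero (W.conductorNorm ℤ)]
    {f : CuspForm (Gamma0 (W.conductorNorm ℤ)) 2} (hf : IsNewformOf W f)
    (A : ℕ → ℤ) (hA : ∀ p : ℕ, p.Prime → cuspCoeff f p = (A p : ℂ))
    (A' : WeierstrassCurve ℚ) [A'.IsElliptic] (hNA : A'.conductorNorm ℤ ∣ W.conductorNorm ℤ)
    (e : geomTorsion W (2 : ℕ) ≃+ geomTorsion A' (2 : ℕ))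
    (he : ∀ (σ : absoluteGaloisGroup ℚ) (P : geomTorsion W (2 : ℕ)), e (σ • P) = σ • e P)
    {N₀ : ℕ} [NeZero N₀] (g : CuspForm (Gamma0 N₀) 2) (hg : IsNewformOf A' g)
    (B : ℕ → ℤ) (hB : ∀ p : ℕ, p.Prime → cuspCoeff g p = (B p : ℂ)) (hB2 : Even (B 2))
    (S : Finset ℕ+) (h1S : (1 : ℕ+) ∈ S) (hodd : ∀ t ∈ S, Odd (t : ℕ))
    (hSN : ∀ t ∈ S, N₀ * (t : ℕ) ∣ W.conductorNorm ℤ)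
    (hbad : ∀ (p : ℕ) (hp : p.Prime), p ∣ W.conductorNorm ℤ → ∃ K : CuspForm (Gamma0 (W.conductorNorm ℤ)) 2,
      (∀ γ : Gamma0 (W.conductorNorm ℤ), ∃ m : ℤ, (cuspSymbol K γ).re = m * (plusPeriod g / 2)) ∧
      (haveI : NeZero p := ⟨hp.ne_zero⟩; heckeT (Gamma0 (W.conductorNorm ℤ)) 2 p
        (∑ t ∈ S, degeneracyMap0 N₀ (W.conductorNorm ℤ) (t : ℕ) 2 g)) =
        ((A p : ℤ) : ℂ) • (∑ t ∈ S, degeneracyMap0 N₀ (W.conductorNorm ℤ) (t : ℕ) 2 g) + (2 : ℂ) • K)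
    (hG : CuspSpanEvenAtTwo N₀) :
    ∀ Lplus Lminus : IwasawaAlgebra 2, IsPollackPair f 2 Lplus Lminus → ¬ PowerSeries.C (2 : ℤ_[2]) ∣ Lminus := by
  have h1 : N₀ * 1 ∣ W.conductorNorm ℤ := by simpa using hSN 1 h1S
  have h2N : ¬ 2 ∣ W.conductorNorm ℤ := by
    rw [W.dvd_conductorNorm_iff_not_hasGoodReductionAtPrime 2, not_not]
    exact hss.1
  have h2N₀ : ¬ 2 ∣ N₀ := fun h ↦ h2N (h.trans ((dvd_mul_right N₀ 1).trans h1))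
  exact flatAtTwo_turnkey_oldSum hBuz hSe hSD hMK hss ha hΔ hf A hA A' hNA e he g hg B hB hB2 S h1S hodd hSN hbad
    (exists_odd_ratPlusSymbol_of_cuspSpanEvenAtTwo g hg.1 hg.coeffField_eq_bot h2N₀ (hB 2 Nat.prime_two) hB2 hG)

/-- **Per-class turnkey at a single level-raising prime, the residue discharged by (G′) at the anchor level.** As
`flatAtTwo_turnkey_prime_level` (`N_W = N₀ · q`, `q` prime, `q ∤ N₀`; anchor `A'` with newform `g` of level `N₀` and an equivariant
`W[2] ≃+ A'[2]`; parities `B 2`, `B q` even, `A q` odd, `A p ≡ B p` at `p ∣ N₀`; the four named facts), with `hres` REPLACED by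
`CuspSpanEvenAtTwo N₀`. For `N₀ = p` a prime with `⟨−1, 4⟩ = (ℤ/p)ˣ` the last hypothesis is lead g6's theorem, so FLAT at `2` holds
on the whole infinite family of conductors `p·q` so anchored, with NO `L`-value input (modulo the named facts). BSD is not proved by
this. [cite: Pollack2003, Conj. 6.3] [cite: Buzzard2000LevelLoweringModTwo, Prop. 2.4] [cite: DarmonDiamondTaylor1995, §1.6 Lemma 1.38]
[cite: SerreInventiones1972, §1.11 Prop. 12] [cite: Mazur1978, Thm. 1] [cite: EmertonPollackWeston2006, §4.4] -/
theorem flatAtTwo_turnkey_prime_level_of_cuspSpanEvenAtTwo (hBuz : buzzard2000_multiplicityOne_gamma0)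
    (hSe : serre1972_supersingular_decompositionSubgroup_image) (hSD : heckeSelfDual_torsionBy_J0)
    (hMK : mazurKenku_exists_cyclic_isogeny)
    (hss : GoodSS W 2) (ha : W.frobeniusTrace 2 = 0) (hΔ : W.Δ < 0) [NeZero (W.conductorNorm ℤ)]
    {f : CuspForm (Gamma0 (W.conductorNorm ℤ)) 2} (hf : IsNewformOf W f)
    (A : ℕ → ℤ) (hA : ∀ p : ℕ, p.Prime → cuspCoeff f p = (A p : ℂ))
    (A' : WeierstrassCurve ℚ) [A'.IsElliptic] (hNA : A'.conductorNorm ℤ ∣ W.conductorNorm ℤ)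
    (e : geomTorsion W (2 : ℕ) ≃+ geomTorsion A' (2 : ℕ))
    (he : ∀ (σ : absoluteGaloisGroup ℚ) (P : geomTorsion W (2 : ℕ)), e (σ • P) = σ • e P)
    {N₀ q : ℕ} [NeZero N₀] (hq : q.Prime) (hqN₀ : ¬ q ∣ N₀) (hN : N₀ * q = W.conductorNorm ℤ)
    (g : CuspForm (Gamma0 N₀) 2) (hg : IsNewformOf A' g)
    (B : ℕ → ℤ) (hB : ∀ p : ℕ, p.Prime → cuspCoeff g p = (B p : ℂ)) (hB2 : Even (B 2)) (hBq : Even (B q)) (hAq : Odd (A q))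
    (hcongr₀ : ∀ p : ℕ, p.Prime → p ∣ N₀ → ((A p : ℤ) : ZMod 2) = ((B p : ℤ) : ZMod 2))
    (hG : CuspSpanEvenAtTwo N₀) :
    ∀ Lplus Lminus : IwasawaAlgebra 2, IsPollackPair f 2 Lplus Lminus → ¬ PowerSeries.C (2 : ℤ_[2]) ∣ Lminus := by
  have h2N : ¬ 2 ∣ W.conductorNorm ℤ := by
    rw [W.dvd_conductorNorm_iff_not_hasGoodReductionAtPrime 2, not_not]
    exact hss.1
  have h2N₀ : ¬ 2 ∣ N₀ := fun h ↦ h2N (h.trans (hN ▸ dvd_mul_right N₀ q))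
  exact flatAtTwo_turnkey_prime_level hBuz hSe hSD hMK hss ha hΔ hf A hA A' hNA e he hq hqN₀ hN g hg B hB hB2 hBq hAq hcongr₀
    (exists_odd_ratPlusSymbol_of_cuspSpanEvenAtTwo g hg.1 hg.coeffField_eq_bot h2N₀ (hB 2 Nat.prime_two) hB2 hG)

end MultOneDictionary

end Summit.BirchSwinnertonDyer.BirchSwinnertonDyer.Theorems.SignedMuAtTwo

end
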